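import Summits.AtomisticToContinuum.HydrodynamicLimit.Theorems.BoxDissipativeWeakStrongRelativeEnergyStabilityDefs
import Summits.AtomisticToContinuum.HydrodynamicLimit.Theorems.BoxDissipativeWeakStrongEntropyAdmissibilityStubConcentrationOfPTBCA
import Literature.Analysis.FunctionSpaces.TorusSpaceTimeKernel
import Literature.Analysis.FluidPDE.HardSphereDynamicsProofs
import Literature.MathematicalPhysics.KineticTheory.HardSphereBBGKYLiouvilleFlow
import Mathlib.Analysis.Calculus.FDeriv.Measurable
import HarnessLib

/-!
# Crux `RelativeEnergyStability` (stmt-AtomisticToContinuum-17653), line `registered`: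
stub `stub_boxBalanceLaws` (S-B) — exact pathwise balance laws of the box fields on the good set

For `σ > 0`, a hard-sphere flow `Φ` of `N+1` spheres on `𝕋³`, a window `0 < l ≤ 1` and `z ∈ Φ.good`, the box
fields `ρ̂, m̂, Ê` (empirical fields tested against the box kernel `K_l(x, ·)`) satisfy
`RES.BoxBalanceLawsFor σ N Φ l z`: (i) `∫ ρ̂ dx = 1` and (ii) `∫ Ê dx = KE/(N+1)` (the kernel is symmetric
with unit mass, `LGFS.integral_boxK_right`; the fields are finite averages); (iii) `KE` is conserved
(`HardSphereFlow.configEnergy_flow`); (iv) the box continuity equation tested with `φ` jointly smooth on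
`[0, T) × 𝕋³` holds EXACTLY on `[0, τ]`, `τ < T`. Proof of (iv): by translation/reflection invariance of
Haar measure a box average is a mollification by the reduced kernel `k_l = K_l(0, ·) ∈ L¹`,
`∫ K_l(x, y) f(x) dx = (k_l ⋆ f)(y)`, so `∫ ρ̂(t) φ(t) dx = (N+1)⁻¹ Σ_k ψ(t, x_k(t))` with `ψ(t) = k_l ⋆ φ(t)`
jointly smooth on `[0, b] × 𝕋³`, `τ < b < T` (`Torus.isSmoothSpaceTimeOn_convolution_Icc`; `∂ₜψ = k_l ⋆ ∂ₜφ`,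
`Dψ v = k_l ⋆ ⟪v, ∇φ⟫`). Positions are continuous and the orbit is free flight on a stretch to the right
of every time (`IsHardSphereTrajectory.free`), so `t ↦ Σ_k ψ(t, x_k(t))` is continuous (tube lemma) with
the bounded right derivative `Σ_k (∂ₜψ(t, x_k) + Dψ_t(x_k) v_k) = (N+1) ∫ (ρ̂ ∂ₜφ + m̂·∇φ) dx` (chain rule
through the space–time lift); the FTC for right derivatives concludes (the derivative is measurable as
a right derivative, `measurable_derivWithin_Ioi`). References: Spohn 1991, Part I §3.2; GST 2013,
Prop. 4.1.1; Evans 2010, App. C.4 Thm. 7 (i); BrezinaFeireisl2018 §3.2 (consumer).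
-/

noncomputable section

namespace Summit.AtomisticToContinuum.HydrodynamicLimit.Theorems.RES

open MeasureTheory Filter Set
open scoped ENNReal Topology Convolution InnerProductSpace
open Literature.MathematicalPhysics.KineticTheory Literature.Analysis.FluidPDE
open Literature.Analysis.FunctionSpaces

/-! ## The box kernel: the reduced kernel and mollification

The box kernel of this line (`RES.boxKernel`) is definitionally the one of `BDWS`/`EABirthS2bA`, whose
symmetry, unit mass and integrability in the centre variable are reused. -/

/-- The reduced kernel `k_l = K_l(0, ·)` is integrable. -/
theorem bb_integrable_boxKernel_zero {l : ℝ} (hl : 0 ≤ l) :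
    Integrable (boxKernel l 0) (volume : Measure T3) := by
  have h : boxKernel l 0 = fun w => boxKernel l w 0 := funext fun w => EABirthS2bA.boxKernel_comm l 0 w
  rw [h]
  exact EABirthS0b.integrable_boxKernel_left hl 0

/-- Translation of the box kernel: `K_l(y - w, y) = k_l(w)`. -/
theorem bb_boxKernel_sub_left (l : ℝ) (y w : T3) : boxKernel l (y - w) y = boxKernel l 0 w := by
  simp only [boxKernel, Set.indicator_apply, Set.mem_setOf_eq, Pi.sub_apply, Pi.zero_apply,
    sub_sub_cancel, sub_zero]

/-- **Box averages are mollifications** by the reduced kernel: `∫ K_l(x, y) f(x) dx = (k_l ⋆ f)(y)`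
(substitute `x = y - w`; Haar measure on the abelian group `𝕋³` is translation and reflection invariant). -/
theorem bb_integral_boxKernel_mul (l : ℝ) (f : T3 → ℝ) (y : T3) :
    ∫ x, boxKernel l x y * f x = (boxKernel l 0 ⋆ f) y := by
  haveI : (volume : Measure T3).IsNegInvariant := Measure.IsAddHaarMeasure.isNegInvariant_of_regular _
  rw [convolution_lsmul, ← integral_sub_left_eq_self (fun x => boxKernel l x y * f x) volume y]
  refine integral_congr_ae (ae_of_all _ fun w => ?_)
  simp only [bb_boxKernel_sub_left, smul_eq_mul]

/-- A box average of a continuous function has an integrable integrand. -/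
theorem bb_integrable_boxKernel_mul {l : ℝ} (hl : 0 ≤ l) (y : T3) {f : T3 → ℝ} (hf : Continuous f) :
    Integrable fun x : T3 => boxKernel l x y * f x := by
  obtain ⟨C, hC⟩ := Torus.exists_forall_norm_le_of_continuous hf
  have h := Integrable.bdd_mul (EABirthS0b.integrable_boxKernel_left hl y) hf.aestronglyMeasurable
    (ae_of_all _ hC)
  exact h.congr (ae_of_all _ fun x => mul_comm _ _)

/-! ## Instantaneous identities for the box fields of one configuration -/

/-- **Box energy**: `∫ Ê dx = KE(w)/(n+1)` for `0 < l ≤ 1`. -/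
theorem bb_integral_energy {n : ℕ} (w : Config (n + 1) (Fin 3) T3) {l : ℝ} (hl : 0 < l)
    (hl1 : l ≤ 1) :
    ∫ x, empiricalEnergyField w (boxKernel l x) = ((n : ℝ) + 1)⁻¹ * configEnergy w := by
  have hK : ∀ y, ∫ x, boxKernel l x y = 1 := fun y => EABirthS2bA.integral_boxKernel_left hl hl1 y
  simp_rw [empiricalEnergyField_eq_sum]
  rw [integral_const_mul, integral_finsetSum _
    (f := fun i x => boxKernel l x (w i).1 * (‖(w i).2‖ ^ 2 / 2))
    fun i _ => (EABirthS0b.integrable_boxKernel_left hl.le _).mul_const _]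
  simp_rw [integral_mul_const, hK, one_mul]
  have h : ∑ i, ‖(w i).2‖ ^ 2 / 2 = 2⁻¹ * ∑ i, ‖(w i).2‖ ^ 2 := by
    rw [Finset.mul_sum]
    exact Finset.sum_congr rfl fun i _ => by ring
  rw [h, configEnergy]
  push_cast
  ring

/-- `∫ ρ̂(x) f(x) dx = n⁻¹ Σ_k (k_l ⋆ f)(x_k)` for continuous `f`. -/
theorem bb_integral_density_mul {n : ℕ} (w : Config n (Fin 3) T3) {l : ℝ} (hl : 0 ≤ l)
    {f : T3 → ℝ} (hf : Continuous f) :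
    ∫ x, empiricalDensityField w (boxKernel l x) * f x =
      (n : ℝ)⁻¹ * ∑ k, (boxKernel l 0 ⋆ f) (w k).1 := by
  simp_rw [empiricalDensityField_eq_sum]
  have hpt : ∀ x, (n : ℝ)⁻¹ * (∑ k, boxKernel l x (w k).1) * f x =
      (n : ℝ)⁻¹ * ∑ k, boxKernel l x (w k).1 * f x := fun x => by
    rw [mul_assoc, Finset.sum_mul]
  simp_rw [hpt]
  rw [integral_const_mul, integral_finsetSum _ fun k _ => bb_integrable_boxKernel_mul hl _ hf]
  simp_rw [bb_integral_boxKernel_mul]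

/-- **The streaming integrand of the box continuity equation as particle mollifications**:
`∫ (ρ̂ a + ⟪m̂, g⟫) dx = n⁻¹ Σ_k ((k_l ⋆ a)(x_k) + (k_l ⋆ ⟪v_k, g⟫)(x_k))` for continuous `a`, `g`. -/
theorem bb_integral_streaming {n : ℕ} (w : Config n (Fin 3) T3) {l : ℝ} (hl : 0 ≤ l) {a : T3 → ℝ}
    {g : T3 → V3} (ha : Continuous a) (hg : Continuous g) :
    ∫ x, (empiricalDensityField w (boxKernel l x) * a x +
        ⟪empiricalMomentumField w (boxKernel l x), g x⟫_ℝ) =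
      (n : ℝ)⁻¹ * ∑ k, ((boxKernel l 0 ⋆ a) (w k).1 +
        (boxKernel l 0 ⋆ fun x => ⟪(w k).2, g x⟫_ℝ) (w k).1) := by
  have hpt : ∀ x, empiricalDensityField w (boxKernel l x) * a x +
      ⟪empiricalMomentumField w (boxKernel l x), g x⟫_ℝ =
      (n : ℝ)⁻¹ * ∑ k, (boxKernel l x (w k).1 * a x + boxKernel l x (w k).1 * ⟪(w k).2, g x⟫_ℝ) := by
    intro x
    rw [empiricalDensityField_eq_sum, empiricalMomentumField_eq_sum, real_inner_smul_left, sum_inner,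
      mul_assoc, Finset.sum_mul, ← mul_add, ← Finset.sum_add_distrib]
    refine congrArg _ (Finset.sum_congr rfl fun k _ => ?_)
    rw [real_inner_smul_left]
  have hc : ∀ k : Fin n, Continuous fun x => ⟪(w k).2, g x⟫_ℝ := fun k => continuous_const.inner hg
  simp_rw [hpt]
  rw [integral_const_mul, integral_finsetSum _
    (f := fun k x => boxKernel l x (w k).1 * a x + boxKernel l x (w k).1 * ⟪(w k).2, g x⟫_ℝ)
    fun k _ => (bb_integrable_boxKernel_mul hl _ ha).add (bb_integrable_boxKernel_mul hl _ (hc k))]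
  refine congrArg _ (Finset.sum_congr rfl fun k _ => ?_)
  rw [integral_add (bb_integrable_boxKernel_mul hl _ ha) (bb_integrable_boxKernel_mul hl _ (hc k)),
    bb_integral_boxKernel_mul, bb_integral_boxKernel_mul]

/-! ## Derivatives of the mollified test field -/

/-- Time derivative of the mollified field within `[0, b] ⊂ [0, T)`:
`∂ₜ(k_l ⋆ φ)(s, ·) = k_l ⋆ ∂ₜ^{[0,T)}φ(s, ·)`. -/
theorem bb_timeDerivWithin_conv {l : ℝ} (hl : 0 ≤ l) {T b : ℝ} (hb0 : 0 < b) (hbT : b < T)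
    {φ : ℝ → T3 → ℝ} (hφ : Torus.IsSmoothSpaceTimeOn (Ico 0 T) φ) {s : ℝ} (hs : s ∈ Icc 0 b) (y : T3) :
    Torus.timeDerivWithin (Icc 0 b) (fun t => boxKernel l 0 ⋆ φ t) s y =
      (boxKernel l 0 ⋆ Torus.timeDerivWithin (Ico 0 T) φ s) y := by
  rw [Torus.timeDerivWithin_convolution_Icc (bb_integrable_boxKernel_zero hl) hb0
    (hφ.mono (Icc_subset_Ico_right hbT)) hs y]
  have hfun : Torus.timeDerivWithin (Icc 0 b) φ s = Torus.timeDerivWithin (Ico 0 T) φ s :=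
    funext fun x => derivWithin_subset (Icc_subset_Ico_right hbT) (uniqueDiffOn_Icc hb0 s hs)
      (hφ.hasDerivWithinAt_slice ⟨hs.1, hs.2.trans_lt hbT⟩ x).differentiableWithinAt
  rw [hfun]

/-- Space derivative of a mollified smooth function: `D(k_l ⋆ f)(y) v = (k_l ⋆ ⟪v, ∇f⟫)(y)`. -/
theorem bb_fderiv_conv {l : ℝ} (hl : 0 ≤ l) {f : T3 → ℝ} (hf : Torus.IsSmooth f) (y : T3) (v : V3) :
    Torus.fderiv (boxKernel l 0 ⋆ f) y v = (boxKernel l 0 ⋆ fun x => ⟪v, Torus.gradient f x⟫_ℝ) y := by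
  have hf1 : Torus.IsContDiff 1 f := hf.isContDiff (by simp)
  rw [Torus.torusFderiv_convolution_apply (bb_integrable_boxKernel_zero hl) hf1]
  have hfun : (fun x => Torus.lineDeriv f x v) = fun x => ⟪v, Torus.gradient f x⟫_ℝ :=
    funext fun x => by
      rw [Torus.lineDeriv_eq_fderiv_apply hf1, ← Torus.inner_gradient_left, real_inner_comm]
  rw [hfun]

/-! ## Calculus along free flight and along a hard-sphere trajectory -/

/-- **Differentiation along free flight of a jointly smooth field**: for `ψ` jointly smooth on
`[a, b] × 𝕋³`, `r ↦ ψ(r, x + (r - s)v)` has one-sided derivative `∂ₜψ(s, x) + Dψ_s(x) v` within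
`[a, b]` at `s` (chain rule through the space–time lift). -/
theorem bb_hasDerivWithinAt_freeFlight {ψ : ℝ → T3 → ℝ} {a b : ℝ}
    (hψ : Torus.IsSmoothSpaceTimeOn (Icc a b) ψ) (hab : a < b) {s : ℝ} (hs : s ∈ Icc a b) (x : T3)
    (v : V3) :
    HasDerivWithinAt (fun r => ψ r (x + Torus.proj ((r - s) • v)))
      (Torus.timeDerivWithin (Icc a b) ψ s x + Torus.fderiv (ψ s) x v) (Icc a b) s := by
  obtain ⟨X, rfl⟩ := Torus.proj_surjective x
  have h1 : HasFDerivWithinAt (Torus.stLift ψ) (Torus.stDeriv (Icc a b) ψ s (Torus.proj X))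
      (Icc a b ×ˢ univ) (s, X + (s - s) • v) := by
    rw [sub_self, zero_smul, add_zero]
    exact hψ.hasFDerivWithinAt_stLift (uniqueDiffOn_Icc hab) hs X
  have h2 : HasDerivWithinAt (fun r : ℝ => ((r, X + (r - s) • v) : ℝ × V3)) ((1 : ℝ), v)
      (Icc a b) s := by
    refine (hasDerivWithinAt_id s _).prodMk ?_
    have h := (((hasDerivWithinAt_id s (Icc a b)).sub_const s).smul_const v).const_add X
    simpa only [id, one_smul] using h
  have h3 := h1.comp_hasDerivWithinAt s h2 fun r hr => Set.mk_mem_prod hr (mem_univ _)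
  rw [Torus.stDeriv_apply, one_smul] at h3
  exact h3

/-- **Right derivative of a position observable with a jointly smooth time-dependent test field
along a hard-sphere trajectory on `𝕋³`**: `d⁺/ds Σ_k ψ(s, x_k(s)) = Σ_k (∂ₜψ(s, x_k) + Dψ_s(x_k) v_k)`
(the orbit is free flight on a stretch to the right of `s`, `IsHardSphereTrajectory.free`). -/
theorem bb_hasDerivWithinAt_traj {n : ℕ} {ε : ℝ} {γ : ℝ → Config n (Fin 3) T3}
    (hγ : IsHardSphereTrajectory (Literature.Analysis.FluidPDE.Torus.geometry (Fin 3)) ε n γ)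
    {ψ : ℝ → T3 → ℝ} {a b : ℝ} (hψ : Torus.IsSmoothSpaceTimeOn (Icc a b) ψ) (hab : a < b) {s : ℝ}
    (hs : s ∈ Ico a b) :
    HasDerivWithinAt (fun r => ∑ k, ψ r (γ r k).1)
      (∑ k, (Torus.timeDerivWithin (Icc a b) ψ s (γ s k).1 + Torus.fderiv (ψ s) (γ s k).1 (γ s k).2))
      (Ioi s) s := by
  obtain ⟨u, hsu, hfree⟩ := hγ.exists_Ioo_right_free s
  have hs' : s ∈ Icc a b := Ico_subset_Icc_self hs
  have hF : HasDerivWithinAt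
      (fun r => ∑ k, ψ r ((γ s k).1 + Torus.proj ((r - s) • (γ s k).2)))
      (∑ k, (Torus.timeDerivWithin (Icc a b) ψ s (γ s k).1 + Torus.fderiv (ψ s) (γ s k).1 (γ s k).2))
      (Ioi s) s :=
    (HasDerivWithinAt.fun_sum fun k _ => bb_hasDerivWithinAt_freeFlight hψ hab hs' _ _)
      |>.mono_of_mem_nhdsWithin (mem_of_superset (Ioo_mem_nhdsGT hs.2)
        fun r hr => ⟨hs.1.trans hr.1.le, hr.2.le⟩)
  refine hF.congr_of_eventuallyEq ?_ ?_
  · filter_upwards [Ioo_mem_nhdsGT hsu] with r hr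
    rw [hγ.eq_freeFlight_of_Ioo_free hfree ⟨hr.1.le, hr.2⟩]
    simp only [freeFlight_apply, Torus.geometry_translate]
  · simp only [sub_self, zero_smul, Torus.proj_zero, add_zero]

/-- A jointly smooth field evaluated along a continuous path is continuous in time within the time
set (tube lemma over the compact torus, `Torus.IsSmoothSpaceTimeOn.eventually_norm_sub_lt`). -/
theorem bb_continuousWithinAt_eval {S : Set ℝ} {ψ : ℝ → T3 → ℝ} (hψ : Torus.IsSmoothSpaceTimeOn S ψ)
    {p : ℝ → T3} (hp : Continuous p) {r₀ : ℝ} (hr₀ : r₀ ∈ S) :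
    ContinuousWithinAt (fun r => ψ r (p r)) S r₀ := by
  have h2 : Tendsto (fun r => ψ r₀ (p r)) (𝓝[S] r₀) (𝓝 (ψ r₀ (p r₀))) :=
    (((hψ.isSmooth_slice hr₀).continuous.comp hp).tendsto r₀).mono_left nhdsWithin_le_nhds
  have h1 : Tendsto (fun r => ψ r (p r) - ψ r₀ (p r)) (𝓝[S] r₀) (𝓝 0) := by
    rw [Metric.tendsto_nhds]
    intro ε hε
    filter_upwards [hψ.eventually_norm_sub_lt hr₀ hε] with r hr
    rw [dist_zero_right]
    exact hr (p r)
  have h := h1.add h2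
  simp only [sub_add_cancel, zero_add] at h
  exact h

/-- Velocities are bounded by the kinetic energy: `‖v_k‖ ≤ 1 + 2 KE(w)`. -/
theorem bb_norm_vel_le {n : ℕ} (w : Config n (Fin 3) T3) (k : Fin n) :
    ‖(w k).2‖ ≤ 1 + 2 * configEnergy w := by
  have h1 : ‖(w k).2‖ ^ 2 ≤ ∑ j, ‖(w j).2‖ ^ 2 :=
    Finset.single_le_sum (fun j _ => sq_nonneg ‖(w j).2‖) (Finset.mem_univ k)
  have h2 : 2 * configEnergy w = ∑ j, ‖(w j).2‖ ^ 2 := by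
    rw [configEnergy]; ring
  nlinarith [norm_nonneg (w k).2, sq_nonneg (‖(w k).2‖ - 1)]

/-! ## The fundamental theorem of calculus for right derivatives -/

/-- **FTC for right derivatives with a bounded derivative**: if `H` is continuous on `[a, b]` and has
right derivative `H' s` at every `s ∈ [a, b]` with `|H'| ≤ C` there, then `H'` is integrable on
`(a, b]` and `H b - H a = ∫_{(a,b]} H'` (`H'` is measurable as a right derivative,
`measurable_derivWithin_Ioi`; `intervalIntegral.integral_eq_sub_of_hasDeriv_right_of_le`). -/
theorem bb_ftc_right {H H' : ℝ → ℝ} {a b C : ℝ} (hab : a ≤ b) (hcont : ContinuousOn H (Icc a b))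
    (hderiv : ∀ s ∈ Icc a b, HasDerivWithinAt H (H' s) (Ioi s) s)
    (hbound : ∀ s ∈ Icc a b, |H' s| ≤ C) :
    IntegrableOn H' (Ioc a b) ∧ H b - H a = ∫ s in Ioc a b, H' s := by
  have hmeas : AEStronglyMeasurable H' (volume.restrict (Ioc a b)) := by
    refine (measurable_derivWithin_Ioi H).aestronglyMeasurable.congr ?_
    filter_upwards [ae_restrict_mem measurableSet_Ioc] with s hs
    exact (hderiv s ⟨hs.1.le, hs.2⟩).derivWithin (uniqueDiffWithinAt_Ioi s)
  have hint : IntegrableOn H' (Ioc a b) := by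
    refine Integrable.mono' (integrable_const C) hmeas ?_
    filter_upwards [ae_restrict_mem measurableSet_Ioc] with s hs
    rw [Real.norm_eq_abs]
    exact hbound s ⟨hs.1.le, hs.2⟩
  refine ⟨hint, ?_⟩
  rw [← intervalIntegral.integral_of_le hab,
    intervalIntegral.integral_eq_sub_of_hasDeriv_right_of_le hab hcont
      (fun s hs => hderiv s ⟨hs.1.le, hs.2.le⟩)
      ((intervalIntegrable_iff_integrableOn_Ioc_of_le hab).2 hint)]

/-! ## The mollified position observable along the flow and its streaming term -/

/-- The mollified position observable `H(r) = Σ_k (k_l ⋆ φ(r, ·))(x_k(r))` is continuous on `[0, b]`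
along a hard-sphere trajectory (positions are continuous). -/
theorem bb_obs_continuousOn {n : ℕ} {ε : ℝ} {γ : ℝ → Config n (Fin 3) T3}
    (hγ : IsHardSphereTrajectory (Literature.Analysis.FluidPDE.Torus.geometry (Fin 3)) ε n γ)
    {l : ℝ} (hl : 0 ≤ l) {T b : ℝ} (hb0 : 0 < b) (hbT : b < T) {φ : ℝ → T3 → ℝ}
    (hφ : Torus.IsSmoothSpaceTimeOn (Ico 0 T) φ) :
    ContinuousOn (fun r => ∑ k, (boxKernel l 0 ⋆ φ r) (γ r k).1) (Icc 0 b) := by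
  have hψ : Torus.IsSmoothSpaceTimeOn (Icc 0 b) (fun t => boxKernel l 0 ⋆ φ t) :=
    Torus.isSmoothSpaceTimeOn_convolution_Icc (bb_integrable_boxKernel_zero hl) hb0
      (hφ.mono (Icc_subset_Ico_right hbT))
  exact continuousOn_finsetSum _ fun k _ r hr =>
    bb_continuousWithinAt_eval hψ (hγ.pos_continuous k) hr

/-- The observable has the streaming term
`H'(s) = Σ_k ((k_l ⋆ ∂ₜφ(s, ·))(x_k(s)) + (k_l ⋆ ⟪v_k(s), ∇φ(s, ·)⟫)(x_k(s)))` as right derivative at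
every `s ∈ [0, b)`. -/
theorem bb_obs_hasDerivWithinAt {n : ℕ} {ε : ℝ} {γ : ℝ → Config n (Fin 3) T3}
    (hγ : IsHardSphereTrajectory (Literature.Analysis.FluidPDE.Torus.geometry (Fin 3)) ε n γ)
    {l : ℝ} (hl : 0 ≤ l) {T b : ℝ} (hb0 : 0 < b) (hbT : b < T) {φ : ℝ → T3 → ℝ}
    (hφ : Torus.IsSmoothSpaceTimeOn (Ico 0 T) φ) {s : ℝ} (hs : s ∈ Ico 0 b) :
    HasDerivWithinAt (fun r => ∑ k, (boxKernel l 0 ⋆ φ r) (γ r k).1)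
      (∑ k, ((boxKernel l 0 ⋆ Torus.timeDerivWithin (Ico 0 T) φ s) (γ s k).1 +
        (boxKernel l 0 ⋆ fun x => ⟪(γ s k).2, Torus.gradient (φ s) x⟫_ℝ) (γ s k).1)) (Ioi s) s := by
  have hψ : Torus.IsSmoothSpaceTimeOn (Icc 0 b) (fun t => boxKernel l 0 ⋆ φ t) :=
    Torus.isSmoothSpaceTimeOn_convolution_Icc (bb_integrable_boxKernel_zero hl) hb0
      (hφ.mono (Icc_subset_Ico_right hbT))
  have hD := bb_hasDerivWithinAt_traj hγ hψ hb0 hs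
  have hsT : s ∈ Ico 0 T := ⟨hs.1, hs.2.trans hbT⟩
  refine hD.congr_deriv (Finset.sum_congr rfl fun k _ => ?_)
  rw [bb_timeDerivWithin_conv hl hb0 hbT hφ (Ico_subset_Icc_self hs),
    bb_fderiv_conv hl (hφ.isSmooth_slice hsT)]

/-- The streaming term is bounded on `[0, τ] ⊂ [0, T)` (derivatives of `φ` are bounded on the compact
`[0, τ] × 𝕋³`, velocities by the conserved kinetic energy, and `‖k_l‖_{L¹} = 1`). -/
theorem bb_stream_bound {σ : ℝ} {N : ℕ}
    (Φ : HardSphereFlow (Literature.Analysis.FluidPDE.Torus.geometry (Fin 3)) (hsDiameter σ N) (N + 1))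
    {l : ℝ} (hl : 0 < l) (hl1 : l ≤ 1) {z : Config (N + 1) (Fin 3) T3} (hz : z ∈ Φ.good)
    {T : ℝ} {φ : ℝ → T3 → ℝ} (hφ : Torus.IsSmoothSpaceTimeOn (Ico 0 T) φ) {τ : ℝ} (hτ : τ ∈ Ico 0 T) :
    ∃ C : ℝ, ∀ s ∈ Icc 0 τ,
      |∑ k, ((boxKernel l 0 ⋆ Torus.timeDerivWithin (Ico 0 T) φ s) (Φ.flow s z k).1 +
        (boxKernel l 0 ⋆ fun x => ⟪(Φ.flow s z k).2, Torus.gradient (φ s) x⟫_ℝ) (Φ.flow s z k).1)|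
        ≤ C := by
  have hU : UniqueDiffOn ℝ (Ico 0 T) := uniqueDiffOn_Ico 0 T
  have hK : Icc 0 τ ⊆ Ico 0 T := Icc_subset_Ico_right hτ.2
  obtain ⟨A, hA⟩ := (hφ.timeDerivWithin hU).exists_norm_le_of_isCompact isCompact_Icc hK
  obtain ⟨B, hB⟩ := (hφ.gradient hU).exists_norm_le_of_isCompact isCompact_Icc hK
  set V : ℝ := 1 + 2 * configEnergy z with hV
  have hB0 : 0 ≤ B := (norm_nonneg _).trans (hB 0 ⟨le_rfl, hτ.1⟩ 0)
  have hk := bb_integrable_boxKernel_zero hl.le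
  have hk1 : ∫ w, ‖boxKernel l 0 w‖ = 1 := by  -- `‖k_l‖_{L¹} = 1`
    have h : ∀ w, ‖boxKernel l 0 w‖ = boxKernel l 0 w := fun w => by
      rw [Real.norm_eq_abs]; exact abs_of_nonneg (LGFS.boxK_nonneg hl.le 0 w)
    simp_rw [h]; exact LGFS.integral_boxK_right hl hl1 0
  refine ⟨∑ _k : Fin (N + 1), (A + V * B), fun s hs => ?_⟩
  refine (Finset.abs_sum_le_sum_abs _ _).trans (Finset.sum_le_sum fun k _ => ?_)
  have hv : ‖(Φ.flow s z k).2‖ ≤ V := by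
    rw [hV, ← Φ.configEnergy_flow hz s]
    exact bb_norm_vel_le _ k
  have h1 : ‖(boxKernel l 0 ⋆ Torus.timeDerivWithin (Ico 0 T) φ s) (Φ.flow s z k).1‖ ≤ A := by
    have h := Torus.norm_convolution_le hk (hA s hs) (Φ.flow s z k).1
    rwa [hk1, mul_one] at h
  have h2 : ‖(boxKernel l 0 ⋆ fun x => ⟪(Φ.flow s z k).2, Torus.gradient (φ s) x⟫_ℝ)
      (Φ.flow s z k).1‖ ≤ V * B := by
    have hb : ∀ x, ‖⟪(Φ.flow s z k).2, Torus.gradient (φ s) x⟫_ℝ‖ ≤ V * B := fun x => by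
      rw [Real.norm_eq_abs]
      exact (abs_real_inner_le_norm _ _).trans (mul_le_mul hv (hB s hs x) (norm_nonneg _)
        ((norm_nonneg _).trans hv))
    have h := Torus.norm_convolution_le hk hb (Φ.flow s z k).1
    rwa [hk1, mul_one] at h
  rw [← Real.norm_eq_abs]
  exact (norm_add_le _ _).trans (add_le_add h1 h2)

/-! ## The stub -/

/-- **S-B — exact pathwise balance laws of the box fields on the good set.** For `σ > 0`, a flow `Φ`
of `N+1` spheres, a window `0 < l ≤ 1` and `z ∈ Φ.good`: box mass one (symmetry and unit mass of the
box kernel), box energy `= KE(Φ_t z)/(N+1)`, conservation of `KE` along the orbit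
(`HardSphereFlow.configEnergy_flow`), and the box continuity equation tested with any `φ` jointly
smooth on `[0, T) × 𝕋³` exactly on `[0, τ]`, `τ < T`, with an integrable time integrand (mollification
by the reduced box kernel, right derivatives along hard-sphere trajectories on `[0, b]`, `τ < b < T`,
FTC for right derivatives `bb_ftc_right`). -/
theorem stub_boxBalanceLaws :
    ∀ σ : ℝ, 0 < σ → ∀ (N : ℕ)
      (Φ : HardSphereFlow (Literature.Analysis.FluidPDE.Torus.geometry (Fin 3)) (hsDiameter σ N) (N + 1))
      (l : ℝ), 0 < l → l ≤ 1 → ∀ z ∈ Φ.good, BoxBalanceLawsFor σ N Φ l z := by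
  intro σ _hσ N Φ l hl hl1 z hz
  refine ⟨fun t => EABirthS2bA.integral_density_eq_one hl hl1 _, fun t => bb_integral_energy _ hl hl1,
    fun t => Φ.configEnergy_flow hz t, fun T φ hφ τ hτ => ?_⟩
  have hγ := Φ.isTrajectory z hz
  have hT : 0 < T := hτ.1.trans_lt hτ.2
  have hU : UniqueDiffOn ℝ (Ico 0 T) := uniqueDiffOn_Ico 0 T
  set b : ℝ := (τ + T) / 2 with hb_def
  have hτb : τ < b := by rw [hb_def]; linarith [hτ.2]
  have hbT : b < T := by rw [hb_def]; linarith [hτ.2]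
  have hb0 : 0 < b := hτ.1.trans_lt hτb
  -- the time integrand is `(N+1)⁻¹ H'` on `[0, T)`
  have hI : ∀ s ∈ Ico 0 T, ∫ x,
      (empiricalDensityField (Φ.flow s z) (boxKernel l x) * Torus.timeDerivWithin (Ico 0 T) φ s x +
        ⟪empiricalMomentumField (Φ.flow s z) (boxKernel l x), Torus.gradient (φ s) x⟫_ℝ) =
      ((N + 1 : ℕ) : ℝ)⁻¹ *
        ∑ k, ((boxKernel l 0 ⋆ Torus.timeDerivWithin (Ico 0 T) φ s) (Φ.flow s z k).1 +
          (boxKernel l 0 ⋆ fun x => ⟪(Φ.flow s z k).2, Torus.gradient (φ s) x⟫_ℝ) (Φ.flow s z k).1) :=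
      fun s hs =>
    bb_integral_streaming (Φ.flow s z) hl.le (hφ.isSmooth_timeDerivWithin hU hs).continuous
      (hφ.isSmooth_slice hs).gradient.continuous
  -- the tested box density is `(N+1)⁻¹ H` on `[0, T)`
  have hG : ∀ s ∈ Ico 0 T, ∫ x, empiricalDensityField (Φ.flow s z) (boxKernel l x) * φ s x =
      ((N + 1 : ℕ) : ℝ)⁻¹ * ∑ k, (boxKernel l 0 ⋆ φ s) (Φ.flow s z k).1 := fun s hs =>
    bb_integral_density_mul (Φ.flow s z) hl.le (hφ.isSmooth_slice hs).continuous
  -- FTC for right derivatives on `[0, τ]`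
  obtain ⟨C, hC⟩ := bb_stream_bound Φ hl hl1 hz hφ hτ
  obtain ⟨hint, hEq⟩ := bb_ftc_right hτ.1
    ((bb_obs_continuousOn hγ hl.le hb0 hbT hφ).mono (Icc_subset_Icc_right hτb.le))
    (fun s hs => bb_obs_hasDerivWithinAt hγ hl.le hb0 hbT hφ ⟨hs.1, hs.2.trans_lt hτb⟩) hC
  have hIoc : Ioc 0 τ ⊆ Ico 0 T := fun t ht => ⟨ht.1.le, ht.2.trans_lt hτ.2⟩
  refine ⟨IntegrableOn.congr_fun (hint.const_mul (((N + 1 : ℕ) : ℝ)⁻¹))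
    (fun t ht => (hI t (hIoc ht)).symm) measurableSet_Ioc, ?_⟩
  rw [hG τ hτ, hG 0 ⟨le_rfl, hT⟩, setIntegral_congr_fun measurableSet_Ioc fun t ht => hI t (hIoc ht),
    integral_const_mul]
  linear_combination ((N + 1 : ℕ) : ℝ)⁻¹ * hEq

end Summit.AtomisticToContinuum.HydrodynamicLimit.Theorems.RES

end
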